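import Summits.Langlands.Langlands.Theorems.QuadraticWindowHostInducedRepMemberArch
import Summits.Langlands.Langlands.Theorems.RegularTwistCM.Negative.AdjointShapeCertificates
import Literature.NumberTheory.Automorphic.AutomorphicRepInfinitesimalCharacter
import HarnessLib

/-!
# Sub-stubs ARCH and PANE-ARCH with the infinity-type input cut down to rank one
# (line `one-transparent-pane`, crux `QuadraticWindow.HostInducedRep`, stmt-Langlands-10902; v5, third lead)

The landed `stub_memberArch` / `stub_memberPaneArch` (…MemberArch.lean p103699, …MemberPaneArch.lean
p104124) take the fact-stub `stub_factInf` — existence of infinity types for EVERY automorphic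
representation of EVERY `GL_N` over EVERY number field (Clozel 1990 §3.3; for `N ≥ 3` over a field with
a complex place this is a genuine theorem of the representation theory of `GL_N(ℂ)`, Zhelobenko /
Kostant, XL and absent from the tree).  An audit of the proofs shows the fact is APPLIED only twice:
(i) to `Pind = AI_{F/F₀}(π ⊗ ω)` over the TOTALLY REAL `F₀` — where it is a theorem of the tree
(`RegularTwistCM.Negative.exists_hasInfinityType_of_isTotallyReal` + `exists_hasArchParameter_gl`: over
a totally real field an infinity type carries no pairing information); (ii) to `GL₁` data over the CM
field `K` (`exists_glOne_archParam`, `exists_glOne_archParam_compRelNorm`).  This file re-proves both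
sub-stubs VERBATIM with the hypothesis weakened accordingly to the rank-one statement

    hinf1 : ∀ (K : Type) [Field K] [NumberField K] (hK : isCompact_glFiniteIntegralLevel 1 K)
      (P : AutomorphicRepData (AutomorphyDatum.gl 1 K hK)), P.exists_hasInfinityType

(registered stubs `stub_memberArch_inf1`, `stub_memberPaneArch_inf1`; proofs = the landed ones with the
two call sites changed), so that the closure of the crux consumes `exists_hasInfinityType` in rank ONE
only (where it is the integrality `a - b ∈ ℤ` of a continuous character `z ↦ z^a z̄^b` of `ℂˣ`).
-/

set_option linter.dupNamespace false -- the summit-side namespace `Summit.Langlands.Langlands.…` repeats `Langlands` by design (D-0017 single-conjunct summit)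

noncomputable section

open scoped BigOperators Polynomial Classical ComplexConjugate MatrixGroups Matrix
open Filter Polynomial IsDedekindDomain NumberField NumberField.InfinitePlace NumberField.mixedEmbedding
open Literature.NumberTheory.Automorphic Literature.NumberTheory.GaloisRepresentations
open Summit.Langlands.Langlands.Theorems.HostInducedRep.GrsExplicitDescent

namespace Summit.Langlands.Langlands.Theorems.HostInducedRep.OneTransparentPane

/-- **Sub-stub ARCH with rank-one infinity-type input (`stub_memberArch_inf1`; facts: archimedean
base change `harch`, Henniart's infinity type of an automorphic induction `hHen`, existence of infinity
types IN RANK ONE `hinf1`).**  Statement and proof of the landed `stub_memberArch` verbatim, except that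
the infinity type of `Pind` over the totally real `F₀` is now obtained fact-free
(`exists_hasArchParameter_gl` + `exists_hasInfinityType_of_isTotallyReal`) and the `GL₁` datum of
`θ = ψu νk` over `K` uses `hinf1`.  From `MemberRel`: an infinity type `T` of `τ' = Π_K ⊗ ψ₀` with
`ArchOut` (weakly regular; type-I criterion `χ₀,v(-1) = (-1)^{n+k}` ⇒ `C`-algebraic, `ψ₁` algebraic).
[cite: Clozel1990, §3.3] -/
theorem stub_memberArch_inf1 : ArthurClozel1989_strongLifting_archimedean → Henniart2012_infinityType_of_automorphicInduction → (∀ (K : Type) [Field K] [NumberField K] (hK : isCompact_glFiniteIntegralLevel 1 K) (P : AutomorphicRepData (AutomorphyDatum.gl 1 K hK)), P.exists_hasInfinityType) → ∀ (F₀ F : Type) [Field F₀] [NumberField F₀] [Field F] [NumberField F] [Algebra F₀ F] (τ : F ≃ₐ[F₀] F) (n : ℕ) (hcpt : isCompact_glFiniteIntegralLevel n F) (π : CuspidalAutomorphicRepData n F hcpt) (e : FramedGaloisRep F₀ ℂ 1) (k : ℤ) (ℓ : ℕ) [Fact ℓ.Prime] (eψ : FramedGaloisRep F ℂ 1), Hyps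 τ n π e k ℓ eψ → ∀ (K : Type) [Field K] [NumberField K] [Algebra F₀ K] [IsCMField K], Module.finrank F₀ K = 2 → ∀ (L : Type) [Field L] [NumberField L] [Algebra F L] [Algebra K L] [IsGalois K L] (μ χe : HeckeCharacter F₀) (ω : HeckeCharacter F) (hfin : ω.IsFiniteOrder) (ω₀ : HeckeCharacter F₀) (ψu νk ν : HeckeCharacter K) (Pind : CuspidalAutomorphicRepData (2 * n) F₀ (isCompact_glFiniteIntegralLevel_holds (2 * n) F₀)) (PiK τ' : CuspidalAutomorphicRepData (2 * n) K (isCompact_glFiniteIntegralLevel_holds (2 * n) K)) (P₀ P : CuspidalAutomorphicRepData n L (isCompact_glFiniteIntegralLevel_holds n L)), MemberRel π e eψ k μ χe ω hfin ω₀ ψu νk ν Pind PiK τ' P₀ P → ∃ T : InfinityType K (2 * n), ArchOut k ((χe * ω₀)⁻¹ * μ) τ'.1 (ψu * νk * ν) T := by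
  intro harch hHen hinf1 F₀ F _ _ _ _ _ τ n hcpt π e k ℓ _ eψ hH K _ _ _ _ h2K L _ _ _ _ _ μ χe ω hfin ω₀
    ψu νk ν Pind PiK τ' P₀ P hrel
  have hn : 0 < n := hyps_rank_pos hH
  obtain ⟨hTR, hdeg, -, hreg, -⟩ := hH
  obtain ⟨-, -, -, -, hχ₀fin, -, hres, hνk, hν, hAI, hBC, hW, hW', -⟩ := hrel
  -- the quadratic extensions `F/F₀`, `K/F₀` are Galois and cyclic
  haveI : Algebra.IsQuadraticExtension F₀ F := ⟨hdeg⟩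
  haveI : Module.Finite F₀ F := Module.Finite.of_restrictScalars_finite ℚ F₀ F
  haveI : Algebra.IsSeparable F₀ F := Algebra.IsSeparable.of_integral F₀ F
  haveI : IsGalois F₀ F := Algebra.IsQuadraticExtension.isGalois F₀ F
  haveI : Algebra.IsQuadraticExtension F₀ K := ⟨h2K⟩
  haveI : Module.Finite F₀ K := Module.Finite.of_restrictScalars_finite ℚ F₀ K
  haveI : Algebra.IsSeparable F₀ K := Algebra.IsSeparable.of_integral F₀ K
  haveI : IsGalois F₀ K := Algebra.IsQuadraticExtension.isGalois F₀ K
  have hprimeK : (Module.finrank F₀ K).Prime := by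
    rw [h2K]
    exact Nat.prime_two
  -- Step 1: infinity types of `π ⊗ ω`, `Π`, `Π_K`
  obtain ⟨Tπ, hTπ, hTC, hTreg⟩ := hreg
  have hTπ' : (π.twist ω hfin).1.HasInfinityType Tπ :=
    ⟨hTπ.1, AutomorphicRepData.HasArchParameter.twist π.1 ω hfin hTπ.2⟩
  -- v5 (third lead): the infinity type of `Pind` over the TOTALLY REAL `F₀` needs no fact
  obtain ⟨χ0, hχ0⟩ := Pind.1.exists_hasArchParameter_gl
  haveI : IsTotallyReal F₀ := hTR
  obtain ⟨TP0, hTP0⟩ :=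
    Summit.Langlands.Langlands.Theorems.RegularTwistCM.Negative.exists_hasInfinityType_of_isTotallyReal hχ0
  have hTPind : Pind.1.HasInfinityType (Tπ.automorphicInduction F₀ (2 * n)) :=
    hHen.hasInfinityType_automorphicInduction F₀ F (Algebra.IsQuadraticExtension.isCyclic F₀ F) n 2
      hn hdeg _ _ Pind (π.twist ω hfin) hAI hTP0 hTπ'
  have hTPiK : PiK.1.HasInfinityType ((Tπ.automorphicInduction F₀ (2 * n)).baseChange K) :=
    harch.hasInfinityType_baseChange (Algebra.IsQuadraticExtension.isCyclic F₀ K) hprimeK hBC hTPind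
  -- Step 2: the `GL₁` datum of `θ = ψu νk` and the infinity type of `τ' = Π_K ⊗ θ`
  obtain ⟨χ₁, p, hθ, hp, hpint⟩ := exists_glOne_archParam (hinf1 K _) (ψu * νk)
  obtain ⟨T, hT, hTa, hTmem⟩ := exists_hasInfinityType_twist_glOne χ₁ hθ hp hpint hW hW' hTPiK
  -- Step 3: the exponents of `θ` place by place
  have hc : ∀ u : InfinitePlace K, u.IsComplex := fun u ↦ IsTotallyComplex.isComplex u
  have huniq : ∀ u u' : InfinitePlace K,
      u'.comap (algebraMap F₀ K) = u.comap (algebraMap F₀ K) → u' = u :=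
    fun u u' h ↦ paneArch_eq_of_comap_eq h2K (hc u) (hTR.isReal _) h
  have hplace : ∀ u : {u : InfinitePlace K // u.IsComplex}, ∃ m : ℤ,
      p u.1.embedding = ((k : ℂ) + m) / 2 ∧
      p (ComplexEmbedding.conjugate u.1.embedding) = ((k : ℂ) - m) / 2 ∧
      ((((χe * ω₀)⁻¹ * μ).archComponent (u.1.comap (algebraMap F₀ K)) (-1) : ℂˣ) : ℂ) =
        (-1 : ℂ) ^ m :=
    fun u ↦ archParam_complexPlace_of_restrict χ₁ hθ hp hpint hres hχ₀fin hνk u (hTR.isReal _)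
      (huniq u.1)
  choose m hm using hplace
  refine ⟨T, hT, fun σ ↦ ?_, fun hsgn ↦ ?_⟩
  · -- weak regularity: the two halves over `σ₁ ≠ σ₂`
    obtain ⟨σ₁, σ₂, -, -, -, hsum⟩ := exists_sum_filter_comp_eq_add_of_finrank_eq_two hdeg
      (σ.comp (algebraMap F₀ K)) (fun σ' ↦ (Tπ σ').map ArchWeight.a)
    have hsum' : (∑ σ' ∈ Finset.univ.filter
        (fun σ' : F →+* ℂ ↦ σ'.comp (algebraMap F₀ F) = σ.comp (algebraMap F₀ K)),
          (Tπ σ').map ArchWeight.a) = (Tπ σ₁).map ArchWeight.a + (Tπ σ₂).map ArchWeight.a := hsum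
    refine ⟨((Tπ σ₁).map ArchWeight.a).map (· + p σ), ((Tπ σ₂).map ArchWeight.a).map (· + p σ),
      ?_, ?_, ?_, ?_⟩
    · rw [hTa σ, InfinityType.baseChange_apply, InfinityType.map_automorphicInduction, hsum',
        Multiset.map_add]
    · rw [Multiset.card_map, Multiset.card_map, hTπ.1.1 σ₁, Nat.mul_div_cancel_left n two_pos]
    · exact (hTreg σ₁).map (add_left_injective (p σ))
    · exact (hTreg σ₂).map (add_left_injective (p σ))
  · -- the type-I criterion: parities `m_u ≡ n + k`
    have hpar : ∀ u : {u : InfinitePlace K // u.IsComplex}, ∃ j : ℤ, m u = n + k + 2 * j := by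
      intro u
      obtain ⟨-, -, hmu⟩ := hm u
      have h := (hsgn (u.1.comap (algebraMap F₀ K))).symm.trans hmu
      rcases Int.even_or_odd (m u - (n + k)) with ⟨j, hj⟩ | hodd
      · exact ⟨j, by omega⟩
      · exfalso
        have h1 : (-1 : ℂ) ^ (m u - ((n : ℤ) + k)) = 1 := by
          rw [zpow_sub₀ (by norm_num : (-1 : ℂ) ≠ 0), ← h, div_self (zpow_ne_zero _ (by norm_num))]
        rw [hodd.neg_one_zpow] at h1
        norm_num at h1
    choose j hj using hpar
    -- `p σ ∈ n/2 + ℤ` for every `σ`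
    have hpσ : ∀ σ : K →+* ℂ, ∃ i : ℤ, p σ = (i : ℂ) + (n : ℂ) / 2 := by
      intro σ
      obtain ⟨hp1, hp2, -⟩ := hm ⟨InfinitePlace.mk σ, hc _⟩
      have hj' : ((m ⟨InfinitePlace.mk σ, hc _⟩ : ℤ) : ℂ) = n + k + 2 * j ⟨InfinitePlace.mk σ, hc _⟩ := by
        exact_mod_cast hj ⟨InfinitePlace.mk σ, hc _⟩
      dsimp only at hp1 hp2
      rcases mk_eq_iff.mp (mk_embedding (InfinitePlace.mk σ)) with h | h
      · rw [h] at hp1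
        exact ⟨k + j ⟨InfinitePlace.mk σ, hc _⟩, by rw [hp1, hj']; push_cast; ring⟩
      · rw [h] at hp2
        exact ⟨-j ⟨InfinitePlace.mk σ, hc _⟩ - n, by rw [hp2, hj']; push_cast; ring⟩
    refine ⟨fun σ wt hwt ↦ ?_, ?_⟩
    · -- `C`-algebraicity of `T`
      obtain ⟨w₀, hw₀, ha, hb⟩ := hTmem σ wt hwt
      rw [InfinityType.baseChange_apply, InfinityType.automorphicInduction_apply] at hw₀
      obtain ⟨σ', -, hw₀'⟩ := Multiset.mem_sum.mp hw₀
      obtain ⟨i, i', hi, hi'⟩ := hTC σ' w₀ hw₀'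
      obtain ⟨i₁, hi₁⟩ := hpσ σ
      obtain ⟨i₂, hi₂⟩ := hpσ (ComplexEmbedding.conjugate σ)
      refine ⟨i + i₁, i' + i₂, ?_, ?_⟩
      · rw [ha, hi, hi₁]
        push_cast
        ring
      · rw [hb, hi', hi₂]
        push_cast
        ring
    · -- algebraicity of `ψ₁ = θ ν`
      refine heckeCharacter_isAlgebraic_of_expIdele (fun u ↦ k + j u) (fun u ↦ -j u - n)
        fun u a ↦ ?_
      obtain ⟨hp1, hp2, -⟩ := hm u
      have hj' : ((m u : ℤ) : ℂ) = n + k + 2 * j u := by exact_mod_cast hj u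
      rw [HeckeCharacter.mul_apply, Units.val_mul, glOne_apply_expIdele_complexPlace χ₁ hθ hp u a,
        normChar_apply_expIdele_complexPlace hν u a, ← Complex.exp_add, hp1, hp2, hj']
      congr 1
      push_cast
      ring

end Summit.Langlands.Langlands.Theorems.HostInducedRep.OneTransparentPane

end
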